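import Summits.ResolutionOfSingularities.KangarooAtlas.MizutaniOperatorBasis
import Literature.AlgebraicGeometry.Resolution.HasseSchmidtDerivatives
import HarnessLib

/-!
# Differential operators of order `≤ m` on a root tower are the `K`-combinations of the `D^{(W)}`, `|W| ≤ m`

Cell topic `Summits/ResolutionOfSingularities/KangarooAtlas` (pub-rosobs); namespace
`Summit.ResolutionOfSingularities.KangarooAtlas.Mizutani`.  Second piece of infrastructure for Mizutani's Lemma 2.9
(Nagoya Math. J. 52 (1973) p. 92–93: «an element `D` of `Diff_2(K/k^p)` with `D ≠ 0` and `D(1) = 0` … Then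
`D = a D_1 D_2 + b D_1^2 + c D_2^2`»).  For a root tower `h : IsRootTower L K q x a` with Hasse–Schmidt operators
`D^{(T)} = h.hsD T` and the `K`-basis `h.hsDBasis` of `End_L(K)` (`MizutaniOperatorBasis.lean`):

* `IsRootTower.commMul_hsD`, **`IsRootTower.isDiffOpLE_hsD`** — `[D^{(T)}, g] = Σ_{T₁+T₂=T, T₁≠0} D^{(T₁)}(g)·D^{(T₂)}`, hence
  `D^{(T)}` is a differential operator of order `≤ |T|` (EGA IV 16.11.2 / 16.8.8);
* `commMul_mul_right`, `commMul_prod_pow_eq_zero` — commutator bookkeeping: an operator commuting with the generators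
  `a_j` commutes with every monomial;
* **`IsRootTower.eq_zero_of_isDiffOpLE_of_forall`** — an operator of order `≤ m` that kills every box monomial `a^N` with
  `|N| ≤ m` is ZERO (induction on `m` through the commutators `[E, a_j]`);
* **`IsRootTower.hsDBasis_repr_eq_zero_of_isDiffOpLE`** — if `D` has order `≤ m` then its coordinates on the `D^{(W)}` with
  `|W| > m` vanish: **`IsRootTower.eq_sum_hsD_of_isDiffOpLE`**, `D = Σ_{|W| ≤ m} c_W D^{(W)}` — the differential operators of
  order `≤ m` of `K/L` are exactly the `K`-span of the `D^{(W)}`, `|W| ≤ m`;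
* (the coordinates at `W = 0`, `W = e_i` and Mizutani's normal form «`D = a D_1D_2 + b D_1^2 + c D_2^2`» are in
  `MizutaniOperatorNormalForm.lean`).

References: [Mizutani1973HironakaGroupSchemes] Lemma 2.9 (proof, p. 93); [EGAIV4] Prop. 16.8.8, Thm. 16.11.2.
-/

noncomputable section

open MvPolynomial Literature.AlgebraicGeometry.Resolution

namespace Summit.ResolutionOfSingularities.KangarooAtlas.Mizutani

universe u

/-! ### Commutator bookkeeping (any commutative algebra) -/

section CommMul

variable {R A : Type*} [CommRing R] [CommRing A] [Algebra R A]

/-- `[E, zw] = [E, z] ∘ (w·) + z·[E, w]`. [cite: EGAIV4, Prop. 16.8.8 (proof)] -/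
theorem commMul_mul_right (E : A →ₗ[R] A) (z w : A) :
    commMul R E (z * w) = commMul R E z ∘ₗ LinearMap.mulLeft R w + z • commMul R E w := by
  ext t
  simp only [commMul_apply, LinearMap.add_apply, LinearMap.comp_apply, LinearMap.mulLeft_apply,
    LinearMap.smul_apply, smul_eq_mul]
  ring

/-- `[E, 1] = 0`. [folklore] -/
theorem commMul_one (E : A →ₗ[R] A) : commMul R E 1 = 0 := by
  ext t
  simp only [commMul_apply, one_mul, LinearMap.zero_apply, sub_self]

/-- If `E` commutes with (multiplication by) `z` and `w`, it commutes with `zw`. [folklore] -/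
theorem commMul_mul_eq_zero {E : A →ₗ[R] A} {z w : A} (hz : commMul R E z = 0) (hw : commMul R E w = 0) :
    commMul R E (z * w) = 0 := by
  rw [commMul_mul_right, hz, hw, LinearMap.zero_comp, smul_zero, add_zero]

/-- If `E` commutes with `z`, it commutes with every power of `z`. [folklore] -/
theorem commMul_pow_eq_zero {E : A →ₗ[R] A} {z : A} (hz : commMul R E z = 0) (n : ℕ) :
    commMul R E (z ^ n) = 0 := by
  induction n with
  | zero => rw [pow_zero]; exact commMul_one E
  | succ n ih => rw [pow_succ]; exact commMul_mul_eq_zero ih hz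

/-- If `E` commutes with every `a_i`, it commutes with every monomial `Π a_i^{N_i}`. [folklore] -/
theorem commMul_prod_pow_eq_zero {ι : Type*} [Fintype ι] {E : A →ₗ[R] A} {a : ι → A}
    (ha : ∀ i, commMul R E (a i) = 0) (N : ι → ℕ) : commMul R E (∏ i, a i ^ N i) = 0 := by
  classical
  induction (Finset.univ : Finset ι) using Finset.induction_on with
  | empty => rw [Finset.prod_empty]; exact commMul_one E
  | insert i s hi ih => rw [Finset.prod_insert hi]; exact commMul_mul_eq_zero (commMul_pow_eq_zero (ha i) _) ih

end CommMul

section OperatorOrder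

variable {L K : Type u} [Field L] [Field K] [Algebra L K] {s p e : ℕ} [hp : Fact p.Prime] [CharP K p]
  {x : Fin s → L} {a : Fin s → K}

/-! ### `D^{(T)}` has order `≤ |T|` -/

/-- The commutator of `D^{(T)}` with a multiplication: `[D^{(T)}, g] = Σ_{T₁+T₂=T, (T₁,T₂)≠(0,T)} D^{(T₁)}(g) · D^{(T₂)}`
(Leibniz minus its first term). [cite: EGAIV4, Prop. 16.8.8 (b) with Thm. 16.11.2] -/
theorem IsRootTower.commMul_hsD (h : IsRootTower L K (p ^ e) x a) {T : Fin s →₀ ℕ} (hT : InBox (p ^ e) T) (g : K) :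
    commMul L (h.hsD T) g =
      ∑ w ∈ (Finset.HasAntidiagonal.antidiagonal T).erase (0, T), h.hsD w.1 g • h.hsD w.2 := by
  classical
  refine LinearMap.ext fun t => ?_
  have h0 : ((0 : Fin s →₀ ℕ), T) ∈ Finset.HasAntidiagonal.antidiagonal T := by simp
  rw [commMul_apply, h.hsD_mul hT, ← Finset.add_sum_erase _ _ h0, LinearMap.sum_apply]
  simp only [h.hsD_zero, LinearMap.id_apply, LinearMap.smul_apply, smul_eq_mul]
  ring

/-- `D^{(0)} y = y`. [folklore] -/
theorem IsRootTower.hsD_zero_apply (h : IsRootTower L K (p ^ e) x a) (y : K) : h.hsD 0 y = y := by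
  rw [h.hsD_zero, LinearMap.id_apply]

/-- **`D^{(T)}` is a differential operator of `K` over `L` of order `≤ |T|`** (`T` in the box).
[cite: EGAIV4, Thm. 16.11.2 (the D_p with |p| ≤ m lie in Diff^m_{A/k})] -/
theorem IsRootTower.isDiffOpLE_hsD (h : IsRootTower L K (p ^ e) x a) :
    ∀ (n : ℕ) {T : Fin s →₀ ℕ} (_ : InBox (p ^ e) T) (_ : T.degree ≤ n), IsDiffOpLE L n (h.hsD T)
  | 0, T, hT, hdeg => by
    have : T = 0 := (Finsupp.degree_eq_zero_iff T).1 (Nat.le_zero.1 hdeg)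
    subst this
    intro g
    refine LinearMap.ext fun t => ?_
    rw [commMul_apply, h.hsD_zero_apply, h.hsD_zero_apply, LinearMap.zero_apply, sub_self]
  | n + 1, T, hT, hdeg => fun g => by
    classical
    rw [h.commMul_hsD hT]
    refine IsDiffOpLE.sum _ fun w hw => IsDiffOpLE.smul _ (h.isDiffOpLE_hsD n ?_ ?_)
    · have hw' : w.1 + w.2 = T := Finset.HasAntidiagonal.mem_antidiagonal.mp (Finset.mem_of_mem_erase hw)
      exact fun j => lt_of_le_of_lt (by rw [← hw']; exact Nat.le_add_left _ _) (hT j)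
    · have := degree_snd_lt_of_mem_erase_antidiagonal hw
      omega

omit hp in
/-- The box index of a box tuple lies in the box. [folklore] -/
theorem inBox_finsuppOf (W : Fin s → Fin (p ^ e)) : InBox (p ^ e) (finsuppOf W) :=
  fun i => by rw [finsuppOf_apply]; exact (W i).2

/-- A `K`-combination of the `D^{(W)}` with `|W| ≤ m` has order `≤ m`. [cite: EGAIV4, Thm. 16.11.2] -/
theorem IsRootTower.isDiffOpLE_sum_smul_hsD (h : IsRootTower L K (p ^ e) x a) (m : ℕ) (c : (Fin s → Fin (p ^ e)) → K)
    (S : Finset (Fin s → Fin (p ^ e))) (hS : ∀ W ∈ S, (finsuppOf W).degree ≤ m) :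
    IsDiffOpLE L m (∑ W ∈ S, c W • h.hsD (finsuppOf W)) :=
  IsDiffOpLE.sum _ fun W hW => IsDiffOpLE.smul _ (h.isDiffOpLE_hsD m (inBox_finsuppOf W) (hS W hW))

/-! ### An operator of order `≤ m` killing the monomials of degree `≤ m` is zero -/

omit [CharP K p] in
/-- `a_j · a^N = a^{N + e_j}`. [folklore] -/
theorem mul_prod_pow_eq (j : Fin s) (N : Fin s →₀ ℕ) :
    a j * ∏ i, a i ^ N i = ∏ i, a i ^ ((N + Finsupp.single j 1 : Fin s →₀ ℕ) i) := by
  classical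
  rw [← Finset.mul_prod_erase Finset.univ _ (Finset.mem_univ j),
    ← Finset.mul_prod_erase Finset.univ (fun i => a i ^ ((N + Finsupp.single j 1 : Fin s →₀ ℕ) i))
      (Finset.mem_univ j),
    Finsupp.add_apply, Finsupp.single_eq_same, pow_succ, ← mul_assoc, mul_comm (a j)]
  congr 1
  refine Finset.prod_congr rfl fun i hi => ?_
  rw [Finsupp.add_apply, Finsupp.single_eq_of_ne (Finset.ne_of_mem_erase hi), add_zero]

omit [CharP K p] in
/-- **Vanishing criterion**: an `L`-linear operator `E` on `K` of order `≤ m` with `E(a^N) = 0` for every `N` with `|N| ≤ m`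
is zero.  Induction on `m`: `[E, a_j]` has order `≤ m − 1` and kills the monomials of degree `≤ m − 1`, so vanishes; then
`E` commutes with every monomial, `E(a^N) = a^N E(1) = 0`, and the monomials span `K`.
[cite: EGAIV4, Prop. 16.8.8 (a differential operator of order ≤ m is determined by finitely many values); Mizutani1973HironakaGroupSchemes, Lemma 2.9 (proof)] -/
theorem IsRootTower.eq_zero_of_isDiffOpLE_of_forall (h : IsRootTower L K (p ^ e) x a) :
    ∀ (m : ℕ) (E : K →ₗ[L] K), IsDiffOpLE L m E →
      (∀ N : Fin s →₀ ℕ, N.degree ≤ m → E (∏ i, a i ^ N i) = 0) → E = 0 := by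
  intro m
  induction m with
  | zero =>
    intro E hE hval
    rw [isDiffOpLE_zero_iff_eq_mulLeft.mp hE]
    have h1 : E 1 = 0 := by
      have := hval 0 (by simp)
      simpa using this
    ext t
    rw [LinearMap.mulLeft_apply, h1, zero_mul, LinearMap.zero_apply]
  | succ m ih =>
    intro E hE hval
    -- each `[E, a_j]` vanishes
    have hcomm : ∀ j, commMul L E (a j) = 0 := by
      intro j
      refine ih _ (hE (a j)) fun N hN => ?_
      have hdeg : (N + Finsupp.single j 1 : Fin s →₀ ℕ).degree ≤ m + 1 := by
        rw [map_add, Finsupp.degree_single]; omega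
      rw [commMul_apply, mul_prod_pow_eq j N, hval (N + Finsupp.single j 1) hdeg, hval N (by omega), mul_zero,
        sub_zero]
    -- hence `E` commutes with every monomial and kills it
    refine h.linearMap_ext_boxMonomials fun N _ => ?_
    have hc := commMul_prod_pow_eq_zero (R := L) hcomm (fun i => N i)
    have happ := congrArg (fun Φ : K →ₗ[L] K => Φ 1) hc
    simp only [commMul_apply, mul_one, LinearMap.zero_apply] at happ
    have h1 : E 1 = 0 := by
      have := hval 0 (by simp)
      simpa using this
    rw [LinearMap.zero_apply, sub_eq_zero.mp happ, h1, mul_zero]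

/-! ### Operators of order `≤ m` are spanned by the `D^{(W)}` with `|W| ≤ m` -/

omit hp in
/-- Degrees are monotone along `≤` on `Fin s →₀ ℕ`. [folklore] -/
theorem degree_le_of_le {T N : Fin s →₀ ℕ} (hle : T ≤ N) : T.degree ≤ N.degree := by
  have hsum : T + (N - T) = N := add_tsub_cancel_of_le hle
  have hdeg : N.degree = T.degree + (N - T).degree := by rw [← map_add, hsum]
  omega

/-- `D^{(W)}` kills the monomials of smaller degree: `D^{(W)} a^N = 0` if `|N| < |W|` (indeed if `W ≰ N`). [folklore] -/
theorem IsRootTower.hsD_prod_pow_eq_zero_of_degree_lt (h : IsRootTower L K (p ^ e) x a) {W N : Fin s →₀ ℕ}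
    (hN : InBox (p ^ e) N) (hlt : N.degree < W.degree) : h.hsD W (∏ i, a i ^ N i) = 0 := by
  have hle : ¬ W ≤ N := fun hle => absurd (degree_le_of_le hle) (not_le.mpr hlt)
  rw [h.hsD_prod_pow' W N hN, mchoose_eq_zero_of_not_le hle, Nat.cast_zero, zero_mul]

omit [CharP K p] in
/-- **Box reduction of a monomial**: `a^N = (Π x_i^{⌊N_i/q⌋}) · a^W` with `W = N mod q` in the box and `W ≤ N`
(`a_i^q = x_i ∈ L`). [cite: Mizutani1973HironakaGroupSchemes, Remark 2.10 (in-house proof §1.1)] -/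
theorem IsRootTower.prod_pow_eq_mul_box (h : IsRootTower L K (p ^ e) x a) (N : Fin s →₀ ℕ) :
    ∃ W : Fin s →₀ ℕ, InBox (p ^ e) W ∧ W ≤ N ∧
      (∏ i, a i ^ N i) = algebraMap L K (∏ i, x i ^ (N i / p ^ e)) * ∏ i, a i ^ W i := by
  have hq : 0 < p ^ e := pow_pos hp.out.pos e
  refine ⟨Finsupp.equivFunOnFinite.symm fun i => N i % p ^ e, fun i => ?_, fun i => ?_, ?_⟩
  · rw [Finsupp.coe_equivFunOnFinite_symm]; exact Nat.mod_lt _ hq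
  · rw [Finsupp.coe_equivFunOnFinite_symm]; exact Nat.mod_le _ _
  · rw [map_prod, ← Finset.prod_mul_distrib]
    refine Finset.prod_congr rfl fun i _ => ?_
    rw [map_pow, ← h.pow_eq i, ← pow_mul, ← pow_add, Finsupp.coe_equivFunOnFinite_symm, Nat.div_add_mod]

/-- **The coordinates of an operator of order `≤ m` on the `D^{(W)}` with `|W| > m` vanish.**
[cite: Mizutani1973HironakaGroupSchemes, Lemma 2.9 (proof: D ∈ Diff_2 is a combination of the D_1^i D_2^j, i + j ≤ 2); EGAIV4, Thm. 16.11.2] -/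
theorem IsRootTower.hsDBasis_repr_eq_zero_of_isDiffOpLE (h : IsRootTower L K (p ^ e) x a) {m : ℕ} {D : K →ₗ[L] K}
    (hD : IsDiffOpLE L m D) {W : Fin s → Fin (p ^ e)} (hW : m < (finsuppOf W).degree) :
    h.hsDBasis.repr D W = 0 := by
  classical
  set c : (Fin s → Fin (p ^ e)) → K := fun W => h.hsDBasis.repr D W with hc
  -- split `D = D₁ + D₂` along `|W| ≤ m`
  set S₁ := (Finset.univ : Finset (Fin s → Fin (p ^ e))).filter fun W => (finsuppOf W).degree ≤ m with hS₁
  set S₂ := (Finset.univ : Finset (Fin s → Fin (p ^ e))).filter fun W => ¬ (finsuppOf W).degree ≤ m with hS₂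
  have hsplit : D = (∑ W ∈ S₁, c W • h.hsD (finsuppOf W)) + ∑ W ∈ S₂, c W • h.hsD (finsuppOf W) := by
    rw [hS₁, hS₂, Finset.sum_filter_add_sum_filter_not]
    exact h.eq_sum_repr_hsD D
  -- `D₂` has order `≤ m` and kills the monomials of degree `≤ m`, hence vanishes
  have hD₂ord : IsDiffOpLE L m (∑ W ∈ S₂, c W • h.hsD (finsuppOf W)) := by
    have hD₁ : IsDiffOpLE L m (∑ W ∈ S₁, c W • h.hsD (finsuppOf W)) :=
      h.isDiffOpLE_sum_smul_hsD m c S₁ fun W hW => (Finset.mem_filter.mp hW).2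
    have := hD.sub hD₁
    rwa [hsplit, add_sub_cancel_left] at this
  have hD₂val : ∀ N : Fin s →₀ ℕ, N.degree ≤ m →
      (∑ W ∈ S₂, c W • h.hsD (finsuppOf W)) (∏ i, a i ^ N i) = 0 := by
    -- box monomials of degree `≤ m` are killed termwise; the others reduce to these over `L`
    have hbox : ∀ M : Fin s →₀ ℕ, InBox (p ^ e) M → M.degree ≤ m →
        (∑ W ∈ S₂, c W • h.hsD (finsuppOf W)) (∏ i, a i ^ M i) = 0 := by
      intro M hMb hM
      rw [LinearMap.sum_apply]
      refine Finset.sum_eq_zero fun W hW => ?_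
      have hWm : m < (finsuppOf W).degree := not_le.mp (Finset.mem_filter.mp hW).2
      rw [LinearMap.smul_apply, h.hsD_prod_pow_eq_zero_of_degree_lt hMb (by omega), smul_zero]
    intro N hN
    obtain ⟨W, hWb, hWN, hred⟩ := h.prod_pow_eq_mul_box N
    rw [hred, ← Algebra.smul_def, map_smul, hbox W hWb ((degree_le_of_le hWN).trans hN), smul_zero]
  have hD₂ := h.eq_zero_of_isDiffOpLE_of_forall m _ hD₂ord hD₂val
  -- read off the coordinate `W`
  have hrel := Fintype.linearIndependent_iff.mp h.linearIndependent_hsD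
    (fun W => if (finsuppOf W).degree ≤ m then 0 else c W) (by
      rw [← hD₂, hS₂, Finset.sum_filter]
      refine Finset.sum_congr rfl fun W _ => ?_
      split_ifs with hle
      · rw [zero_smul]
      · rfl) W
  simp only [not_le.mpr hW, if_false] at hrel
  simpa [hc] using hrel

/-- **Operators of order `≤ m` are the `K`-combinations of the `D^{(W)}` with `|W| ≤ m`.**
[cite: Mizutani1973HironakaGroupSchemes, Lemma 2.9 (proof); EGAIV4, Thm. 16.11.2 (Diff^m is free on the D_p, |p| ≤ m)] -/
theorem IsRootTower.eq_sum_hsD_of_isDiffOpLE (h : IsRootTower L K (p ^ e) x a) {m : ℕ} {D : K →ₗ[L] K}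
    (hD : IsDiffOpLE L m D) :
    D = ∑ W ∈ (Finset.univ : Finset (Fin s → Fin (p ^ e))).filter (fun W => (finsuppOf W).degree ≤ m),
      h.hsDBasis.repr D W • h.hsD (finsuppOf W) := by
  classical
  conv_lhs => rw [h.eq_sum_repr_hsD D]
  rw [← Finset.sum_filter_add_sum_filter_not Finset.univ (fun W => (finsuppOf W).degree ≤ m), add_eq_left]
  refine Finset.sum_eq_zero fun W hW => ?_
  rw [h.hsDBasis_repr_eq_zero_of_isDiffOpLE hD (not_le.mp (Finset.mem_filter.mp hW).2), zero_smul]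

end OperatorOrder

end Summit.ResolutionOfSingularities.KangarooAtlas.Mizutani

end
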